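import Literature.IUT.HodgeArakelov.LabelClassesOfCuspsDef23iiGenuine
import Literature.IUT.HodgeArakelov.ThetaEvaluationSettingRmk221Proofs
import HarnessLib

/-!
# [IUTchII] Def 2.3 (i)/(ii) at a genuine agreement: `Δ^tp_{X̲_v} ≅ Δ^±_v := Π^±_v ∩ Δ̂^cor_v`, and the [CombGC] Prop 1.2 (ii) instance transported
# from the curve side (row «HCT-TRANSPORT»)

S. Mochizuki, *Inter-universal Teichmüller Theory II*, kurims manuscript (Dec. 2020), §2, Def 2.3 (i) p. 67 («`Δ^±_v := Δ^tp_{X_v}`» with `X_v` read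
`X̲_v`; `Δ_v, Δ^±_v, Δ^cor_v` are the intersections with `Δ̂^cor_v = Ker(Π̂^cor_v ↠ G_v)`), Def 2.3 (ii) p. 68 («[cf. [CombGC], Proposition 1.2, (ii)]»)
[cite: Mochizuki2012, II Def 2.3 (i)(ii) pp.67–68]; [CombGC] Prop 1.2 (ii) p. 8 [cite: MochizukiCombGC2007, Prop 1.2(ii) p.8].  abc-iut cell, zone
[IUTchII] §2 (seat abc-iut-L6-t19 gen 6); PROOF-ONLY sequel of `LabelClassesOfCuspsDef23iiGenuine.lean` (p445460).

THE POINT.  p445460 proves the statement of record `Def23_ii'` at the genuine tower GRANTED `hCT`: «every `Π^±_v`-cuspidal `I′` is commensurably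
terminal in `Δ^±_v`», an instance of [CombGC] Prop 1.2 (ii) (FACT-LIST F-0438) phrased on the TOWER side.  This file moves the instance to
the CURVE side, where abc-iut-L3/L5 state such facts: the agreement `A` (clause `A.eHat ∘ emb = toHat ∘ φ`) identifies the geometric tempered
group `Δ^temp_Y` of the [IUTchI] §2 datum `ofSpecialFibre Y …` with `Δ^±_v = Π^±_v ∩ Δ̂^cor_v` (`emb ∘ φ⁻¹`, `A.mem_ker_iff`), and commensurable
terminality is invariant under group isomorphisms (abc-iut-w4's `isCommensurablyTerminal_map_equiv_iff`, p421254).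

* **`StableCurveAgreement.exists_deltaTemp_equiv`** — `∃ ρ : Δ^temp_Y ≃* Δ^±_v` with `ρ(k) = emb (φ⁻¹ k)` (Def 2.3 (i) «`Δ^±_v := Δ^tp_{X_v}`» as a
  kernel identification at the agreement);
* **`StableCurveAgreement.isCommensurablyTerminal_piPM_of_curve`** — if the conjugates `t·I_y·t⁻¹` of the inertia groups of the cusps of `Y` are
  commensurably terminal in `Δ^temp_Y` ([CombGC] Prop 1.2 (ii) / [SemiAnbd] at the curve `Y = X̲_v`: hypothesis `hY`), then every `Π^±_v`-cuspidal
  `I′` is commensurably terminal in `Δ^±_v` — the hypothesis `hCT` of `def23_ii'_genuine` / `def23_ii'_ofPiCHat` (p445460).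

HONEST LABEL: `hY` is a hypothesis (F-0438-class, at the named instance); nothing of the series is asserted; no side taken on [IUTchIII] Cor 3.12.
-/

noncomputable section

namespace Literature.IUT.HodgeArakelov

open Literature.AnabelianGeometry.EtaleTheta Literature.AnabelianGeometry.SemiGraphs Literature.IUT.HodgeTheaters
open Literature.AnabelianGeometry.AbsoluteAnabelian (IsCommensurablyTerminal)
open scoped Pointwise

namespace PlusMinusTower

section DeltaIso

variable {S : BadPlaceSetting.{0}} {P : TopGroup.{0}} {T : TemperedCoverings S P}
variable {p : ℕ} [Fact p.Prime] (Y : TemperedCurve p) (d : Y.GroupLevelData)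
  (Sf : SpecialFibreData (Y.toTemperedArithmeticGroup d)) (h36 : Sf.Gc.Prop36Hypotheses)
  (Sigma SigmaHat : Set ℕ) (hsub : Sigma ⊆ SigmaHat) (hne : Sigma.Nonempty)
  (hprime : ∀ q ∈ SigmaHat, q.Prime) (hp : p ∉ Sigma) (TpH : Subgroup Sf.chart.G)
  (HatH : Subgroup (TemperedGraphGroupData.exists_completion_of_prop36 Sf.Gc h36 Sf.chart).choose)
  (hle : TpH.map (TemperedGraphGroupData.exists_completion_of_prop36 Sf.Gc h36 Sf.chart).choose_spec.choose.toMonoidHom ≤ HatH)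
  (cuspMeetsH : {x : Y.Pt // Y.IsCusp x} → Prop)

/-- Under an agreement with the datum `ofSpecialFibre Y …` (clause `A.eHat ∘ emb = toHat ∘ φ`): `emb w ∈ Δ̂^cor_v ↔ φ w ∈ Δ^temp_Y`.
([IUTchII] Def 2.3 (i), kurims p.67) [claim: Mochizuki2012, status: disputed] -/
theorem StableCurveAgreement.emb_mem_deltaCorHat_iff (W : PlusMinusTower T) {Cu : CuspidalInertiaData W}
    (A : StableCurveAgreement W Cu
      (StableCurveTemperedData.ofSpecialFibre Y d Sf h36 Sigma SigmaHat hsub hne hprime hp TpH HatH hle cuspMeetsH))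
    (φ : T.Xplain ≃ₜ* Y.PiTemp)
    (hA : ∀ w : T.Xplain, A.eHat ⟨W.emb w, W.emb_le_pmHat ⟨w, rfl⟩⟩ =
      (StableCurveTemperedData.ofSpecialFibre Y d Sf h36 Sigma SigmaHat hsub hne hprime hp TpH HatH hle cuspMeetsH).ιX (φ w))
    (w : T.Xplain) : W.emb w ∈ W.deltaCorHat ↔ φ w ∈ Y.DeltaTemp := by
  rw [show (W.emb w ∈ W.deltaCorHat ↔ _) from A.mem_ker_iff ⟨W.emb w, W.emb_le_pmHat ⟨w, rfl⟩⟩, hA w, MonoidHom.mem_ker,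
    ← MonoidHom.comp_apply, StableCurveTemperedData.prHat_comp,
    ← StableCurveTemperedData.OfSpecialFibre.ker_augGK_eq_deltaTemp, MonoidHom.mem_ker]

/-- **[IUTchII] Def 2.3 (i) «`Δ^±_v := Δ^tp_{X_v}`» at the agreement**: the geometric tempered group `Δ^temp_Y` of the [IUTchI] §2 datum is
identified with `Δ^±_v = Π^±_v ∩ Δ̂^cor_v` by `k ↦ emb (φ⁻¹ k)` — an isomorphism of groups (existence form, proof-only).  PROVED.
([IUTchII] Def 2.3 (i), kurims p.67) [cite: Mochizuki2012, II Def 2.3 (i) p.67] [claim: Mochizuki2012, status: disputed] -/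
theorem StableCurveAgreement.exists_deltaTemp_equiv (W : PlusMinusTower T) {Cu : CuspidalInertiaData W}
    (A : StableCurveAgreement W Cu
      (StableCurveTemperedData.ofSpecialFibre Y d Sf h36 Sigma SigmaHat hsub hne hprime hp TpH HatH hle cuspMeetsH))
    (φ : T.Xplain ≃ₜ* Y.PiTemp)
    (hA : ∀ w : T.Xplain, A.eHat ⟨W.emb w, W.emb_le_pmHat ⟨w, rfl⟩⟩ =
      (StableCurveTemperedData.ofSpecialFibre Y d Sf h36 Sigma SigmaHat hsub hne hprime hp TpH HatH hle cuspMeetsH).ιX (φ w)) :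
    ∃ ρ : ↥Y.DeltaTemp ≃* ↥(W.piPM ⊓ W.deltaCorHat),
      ∀ k : Y.DeltaTemp, ((ρ k : ↥(W.piPM ⊓ W.deltaCorHat)) : W.Corhat) = W.emb (φ.symm (k : Y.PiTemp)) := by
  have hmem : ∀ k : Y.DeltaTemp, W.emb (φ.symm (k : Y.PiTemp)) ∈ W.piPM ⊓ W.deltaCorHat := by
    intro k
    refine Subgroup.mem_inf.mpr ⟨⟨_, rfl⟩, ?_⟩
    rw [StableCurveAgreement.emb_mem_deltaCorHat_iff Y d Sf h36 Sigma SigmaHat hsub hne hprime hp TpH HatH hle cuspMeetsH W A φ hA,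
      ContinuousMulEquiv.apply_symm_apply]
    exact k.2
  let f : ↥Y.DeltaTemp →* ↥(W.piPM ⊓ W.deltaCorHat) :=
    { toFun := fun k => ⟨W.emb (φ.symm (k : Y.PiTemp)), hmem k⟩
      map_one' := Subtype.ext (by simp)
      map_mul' := fun a b => Subtype.ext (by simp) }
  have hf_inj : Function.Injective f := by
    intro a b hab
    have h1 : W.emb (φ.symm (a : Y.PiTemp)) = W.emb (φ.symm (b : Y.PiTemp)) := congrArg Subtype.val hab
    exact Subtype.ext (φ.symm.injective (W.emb_injective h1))
  have hf_surj : Function.Surjective f := by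
    rintro ⟨n, hn⟩
    obtain ⟨hn1, hn2⟩ := Subgroup.mem_inf.mp hn
    obtain ⟨w, rfl⟩ := hn1
    have hk : φ w ∈ Y.DeltaTemp :=
      (StableCurveAgreement.emb_mem_deltaCorHat_iff Y d Sf h36 Sigma SigmaHat hsub hne hprime hp TpH HatH hle cuspMeetsH W A φ hA w).mp hn2
    refine ⟨⟨φ w, hk⟩, Subtype.ext ?_⟩
    change W.emb (φ.symm (φ w)) = W.emb w
    rw [ContinuousMulEquiv.symm_apply_apply]
  exact ⟨MulEquiv.ofBijective f ⟨hf_inj, hf_surj⟩, fun _ => rfl⟩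

/-- **The [CombGC] Prop 1.2 (ii) instance, transported from the curve to the tower** (row «HCT-TRANSPORT»): if for every cusp `y` of `Y` and every
`t ∈ Π^tp_Y` the conjugate `t·I_y·t⁻¹` is commensurably terminal in `Δ^temp_Y` (hypothesis `hY`; FACT-LIST F-0438 at the named instance), then
every `Π^±_v`-cuspidal inertia group `I′` of the agreement's cusp datum is commensurably terminal in `Δ^±_v = Π^±_v ∩ Δ̂^cor_v` — the
hypothesis `hCT` of `StableCurveAgreement.def23_ii'_genuine` (p445460).  PROOF: `I′ ∩ … = ρ(t·I_y·t⁻¹)` for the identification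
`ρ : Δ^temp_Y ≅ Δ^±_v` of `exists_deltaTemp_equiv`, and commensurable terminality is invariant under isomorphisms
(`isCommensurablyTerminal_map_equiv_iff`, p421254).  PROVED. ([IUTchII] Def 2.3 (ii), kurims p.68) [cite: Mochizuki2012, II Def 2.3 (ii) p.68]
[cite: MochizukiCombGC2007, Prop 1.2(ii) p.8] [claim: Mochizuki2012, status: disputed] -/
theorem StableCurveAgreement.isCommensurablyTerminal_piPM_of_curve (W : PlusMinusTower T) {Cu : CuspidalInertiaData W}
    (A : StableCurveAgreement W Cu
      (StableCurveTemperedData.ofSpecialFibre Y d Sf h36 Sigma SigmaHat hsub hne hprime hp TpH HatH hle cuspMeetsH))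
    (φ : T.Xplain ≃ₜ* Y.PiTemp)
    (hA : ∀ w : T.Xplain, A.eHat ⟨W.emb w, W.emb_le_pmHat ⟨w, rfl⟩⟩ =
      (StableCurveTemperedData.ofSpecialFibre Y d Sf h36 Sigma SigmaHat hsub hne hprime hp TpH HatH hle cuspMeetsH).ιX (φ w))
    (hY : ∀ (y : (StableCurveTemperedData.ofSpecialFibre Y d Sf h36 Sigma SigmaHat hsub hne hprime hp TpH HatH hle cuspMeetsH).Cusp)
      (t : Y.PiTemp), IsCommensurablyTerminal ((MulAut.conj t •
        (((StableCurveTemperedData.ofSpecialFibre Y d Sf h36 Sigma SigmaHat hsub hne hprime hp TpH HatH hle cuspMeetsH).inertiaTp y).map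
          (StableCurveTemperedData.ofSpecialFibre Y d Sf h36 Sigma SigmaHat hsub hne hprime hp TpH HatH hle cuspMeetsH).DeltaTp.subtype)).subgroupOf
        Y.DeltaTemp))
    {I' : Subgroup W.Corhat} (hI' : Cu.IsCuspidalInertia W.piPM I') :
    IsCommensurablyTerminal (I'.subgroupOf (W.piPM ⊓ W.deltaCorHat)) := by
  obtain ⟨hI'le, y, t, hEq⟩ := (A.inertia_iff I').mp hI'
  obtain ⟨ρ, hρ⟩ := StableCurveAgreement.exists_deltaTemp_equiv Y d Sf h36 Sigma SigmaHat hsub hne hprime hp TpH HatH hle cuspMeetsH W A φ hA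
  -- membership in `I'` of `emb w` is membership of `φ w` in `K = t·I_y·t⁻¹`
  have hmem : ∀ w : T.Xplain, W.emb w ∈ I' ↔ φ w ∈ MulAut.conj t •
      (((StableCurveTemperedData.ofSpecialFibre Y d Sf h36 Sigma SigmaHat hsub hne hprime hp TpH HatH hle cuspMeetsH).inertiaTp y).map
        (StableCurveTemperedData.ofSpecialFibre Y d Sf h36 Sigma SigmaHat hsub hne hprime hp TpH HatH hle cuspMeetsH).DeltaTp.subtype) :=
    fun w => A.emb_mem_iff_of_map_eq (fun w => φ w) hA hEq w
  -- `I' ∩ Δ^±_v = ρ(K ∩ Δ^temp_Y)`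
  have hmap : ((MulAut.conj t •
      (((StableCurveTemperedData.ofSpecialFibre Y d Sf h36 Sigma SigmaHat hsub hne hprime hp TpH HatH hle cuspMeetsH).inertiaTp y).map
        (StableCurveTemperedData.ofSpecialFibre Y d Sf h36 Sigma SigmaHat hsub hne hprime hp TpH HatH hle cuspMeetsH).DeltaTp.subtype)).subgroupOf
        Y.DeltaTemp).map ρ.toMonoidHom = I'.subgroupOf (W.piPM ⊓ W.deltaCorHat) := by
    ext n
    constructor
    · rintro ⟨k, hk, rfl⟩
      rw [Subgroup.mem_subgroupOf]
      change ((ρ k : ↥(W.piPM ⊓ W.deltaCorHat)) : W.Corhat) ∈ I'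
      rw [hρ k, hmem, ContinuousMulEquiv.apply_symm_apply]
      have hk' : k ∈ (_ : Subgroup Y.PiTemp).subgroupOf Y.DeltaTemp := hk
      exact Subgroup.mem_subgroupOf.mp hk'
    · intro hn
      rw [Subgroup.mem_subgroupOf] at hn
      refine ⟨ρ.symm n, ?_, by simp⟩
      rw [SetLike.mem_coe, Subgroup.mem_subgroupOf]
      have h1 : W.emb (φ.symm ((ρ.symm n : Y.DeltaTemp) : Y.PiTemp)) = (n : W.Corhat) := by
        rw [← hρ, MulEquiv.apply_symm_apply]
      have h2 : W.emb (φ.symm ((ρ.symm n : Y.DeltaTemp) : Y.PiTemp)) ∈ I' := by rw [h1]; exact hn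
      have h3 := (hmem _).mp h2
      rwa [ContinuousMulEquiv.apply_symm_apply] at h3
  rw [← hmap]
  exact (isCommensurablyTerminal_map_equiv_iff ρ _).mpr (hY y t)

end DeltaIso

end PlusMinusTower

end Literature.IUT.HodgeArakelov

end
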